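import Mathlib
import HarnessLib
import Summits.AtomisticToContinuum.HydrodynamicLimit.Theses.AnnealedZeroHorizon

/-!
# Route AnnealedZeroHorizon — support `SpreadExcludesLimit` (item stmt-AtomisticToContinuum-9260)

If, at a fixed macroscopic time `t`, for a continuous test function `χ` and some `δ > 0`, the laws
`P N` give probability `≥ δ` to the event `‖⟨m_N(t), χ⟩ − c_N‖ > δ` frequently in `N` for EVERY
deterministic centring `c : ℕ → V3`, then no macroscopic fields `(ρ, u, θ)` whatsoever satisfy
`TendstoHydroFieldsAt P Φ ρ u θ t`.

Proof: pure filter bookkeeping. `TendstoHydroFieldsAt` at `(χ, δ)` says in particular that the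
probability of `‖⟨m_N(t), χ⟩ − ∫ χ ρ(t) u(t)‖ > δ` tends to `0`; with the constant centring
`c_N := ∫ χ ρ(t) u(t)` it is therefore eventually `< ENNReal.ofReal δ` (as `δ > 0`), which is
incompatible with being `≥ ENNReal.ofReal δ` frequently.

Source of the statement: Spohn1991, Part I Ch. 3 (hydrodynamic fields converge in probability to a
deterministic limit); the lemma itself is elementary.
-/

namespace Summit.AtomisticToContinuum.HydrodynamicLimit.Theorems

open Filter Topology

/-- **Spread excludes any deterministic limit** (route AnnealedZeroHorizon, support item
stmt-AtomisticToContinuum-9260). For any laws `P N`, flows `Φ N`, time `t`, continuous `χ` and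
`δ > 0`: if for every centring `c : ℕ → V3` frequently in `N` one has
`ENNReal.ofReal δ ≤ P N {‖⟨m_N(t),χ⟩ − c N‖ > δ}`, then `TendstoHydroFieldsAt P Φ ρ u θ t` fails
for all fields `(ρ, u, θ)`. Proof: specialise the momentum clause of `TendstoHydroFieldsAt` to
`(χ, δ)` and the spread hypothesis to the constant centring `∫ (χ·ρ t) • u t`; a sequence tending
to `0` in `ℝ≥0∞` is eventually `< ofReal δ`, contradicting `≥ ofReal δ` frequently. -/
theorem spreadExcludesLimit_proof :
    Summit.AtomisticToContinuum.HydrodynamicLimit.Theses.AnnealedZeroHorizon.SpreadExcludesLimit := by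
  unfold Summit.AtomisticToContinuum.HydrodynamicLimit.Theses.AnnealedZeroHorizon.SpreadExcludesLimit
  intro ε P Φ t χ δ hχ hδ hspread ρ θ u hT
  obtain ⟨-, hm, -⟩ := hT χ hχ δ hδ
  have hδ' : (0 : ENNReal) < ENNReal.ofReal δ := ENNReal.ofReal_pos.mpr hδ
  have hev := hm.eventually (eventually_lt_nhds hδ')
  obtain ⟨N, hN₁, hN₂⟩ :=
    ((hspread (fun _ => ∫ x, (χ x * ρ t x) • u t x)).and_eventually hev).exists
  exact absurd hN₁ (not_le.mpr hN₂)

end Summit.AtomisticToContinuum.HydrodynamicLimit.Theorems
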